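import Summits.BirchSwinnertonDyer.BirchSwinnertonDyer.Theorems.KimAtThreeD7uTamagawaIndexCorollaries
import HarnessLib

/-!
# The TAMAGAWA-DIVISIBLE bad places, X: the elementary-divisor condition `Φ_v[p^k] ⊆ p Φ_v` on the component
# group, and its descent to the core of `E[p^∞]^{I_v}` (the hypothesis of Büyükboduk 2009 Prop. 2.7 for `T_pE`)
# (cell `bsd-addord`, seat w2-tamdiv gen 5; route W2 `KimAtThreeKolyvagin`, items 19562 / 19560, «TamDiv∞»,
# exponent `≥ 2`)

HONEST FRAMING: TOOL theorems (no definition, no named fact, no `sorry`); closes nothing by itself;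
nothing is booked; BSD is not proved by any of this.  Continues parts I–IX of this series (seat gens 3–4:
the core of `E[p^∞]^{I}`, `φ − 1` onto the core, core = `E₀`-part, the Galois descent to `Φ_v`, the
finite-level Tamagawa index `#𝓕_can(w)_k = #𝓕_u(w)_k · #Φ_w[p^{k+1}]`, the exponent-one defect).

## Why

Büyükboduk, JNT 129 (2009) Prop. 2.7: for local conditions `𝓖 ≤ 𝓕` on `T` with `H¹(ℚ_ℓ,T)/H¹_𝓕` torsion-free,
`𝓖` is CARTESIAN on `T/𝔪ⁿ` as soon as `(H¹_𝓕/H¹_𝓖) ⊗ R/𝔪ⁿ` is free; for `T = T_pE`, `𝓕 = 𝓕_can`, `𝓖 = 𝓕_{u-ℓ}`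
the quotient is `Φ_ℓ[p^∞]` (Remark 2; part VII of this series), so the condition at level `p^{k+1}` reads
«every cyclic factor of `Φ_ℓ[p^∞]` has order `≥ p^{k+1}`», i.e. **`Φ_ℓ[p^k] ⊆ p Φ_ℓ`** (for a cyclic `p`-part:
`p ∤ c_ℓ` or `p^{k+1} ∣ c_ℓ`).  This file states that condition on the tree's component quotient
`Φ_v = X(K_v)/X₀(K_v)` of the minimal model (`#Φ_v = c_v`) and transports it to the TORSION currency in which
the sequel `KimAtThreeD7uTamagawaCartesian` proves the cartesian property:

* §1 (any number field `K`, `v ∤ p`) **`exists_core_add_smul_of_componentQuotient`**: if `Φ_v[p^k] ⊆ p Φ_v`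
  then every `D_{𝔓₀}`-fixed `Q ∈ E[p^∞]` with `p^k • Q` in the core is `c + p • γ`, `c` core, `γ`
  `D_{𝔓₀}`-fixed — through part IV's descent `δ : E[p^∞]^{D} → Φ_v` (kernel = core, image ⊇ `Φ_v[p^∞]`).
* §2 (`ℚ`) dischargers of the condition: `componentQuotient_torsionBy_le_smul_of_not_dvd` (`p ∤ c_w`, every
  `k`) and `componentQuotient_torsionBy_le_smul_of_generator` (`Φ_w[p^∞]` generated by one element and
  `p^{k+1} ∣ c_w`; by Kodaira–Néron `Φ_w[p^∞]` is cyclic for every odd `p`).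

References: K. Büyükboduk, JNT 129 (2009) §2.1.2 Remark 2, §2.4 Lemma 2.6, Prop. 2.7, §3 Thm. 3.1, Cor. 3.3;
B. Mazur, K. Rubin, Mem. AMS 799 (2004) Lemma 3.7.1, App. A Remark A.5; R. Greenberg, LNM 1716 (1999) §3
Lemma 3.3; J. H. Silverman, *AEC* VII.6.1, C.15.2.1.
-/

noncomputable section

-- the cell's Theorems namespace `Summit.BirchSwinnertonDyer.BirchSwinnertonDyer.…` repeats the summit name by design (D-0017)
set_option linter.dupNamespace false

open Function Field IsDedekindDomain NumberField
open scoped NumberField Classical NNReal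
open Literature.NumberTheory.GaloisRepresentations Literature.NumberTheory.EllipticCurves
open Literature.NumberTheory.EllipticCurves.GreenbergSelmer
open WeierstrassCurve
open Summit.BirchSwinnertonDyer.Rank1Residual.X11b.AcSelmer
open Summit.BirchSwinnertonDyer.Rank1Residual.GaloisImage
open Summit.BirchSwinnertonDyer.Rank1Residual.GaloisImage.InertiaDivisible
open Summit.BirchSwinnertonDyer.BirchSwinnertonDyer.Theorems.KimAtThreeD7uTamagawaCore
open Summit.BirchSwinnertonDyer.BirchSwinnertonDyer.Theorems.KimAtThreeD7uTamagawaComponent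
open Summit.BirchSwinnertonDyer.BirchSwinnertonDyer.Theorems.KimAtThreeD7uTamagawaIndex

namespace Summit.BirchSwinnertonDyer.BirchSwinnertonDyer.Theorems.KimAtThreeD7uTamagawaCartesian

/-! ### §1 From the component group `Φ_v` to the core: `Φ_v[p^k] ⊆ p Φ_v` gives the hypothesis `hH` -/

section Descent

variable {K : Type} [Field K] [NumberField K] (W : WeierstrassCurve K) [W.IsElliptic] (p : ℕ)
  [hp : Fact p.Prime] {v : HeightOneSpectrum (𝓞 K)}

/-- **The elementary-divisor condition on `Φ_v` descends to the core** (any number field `K`, `v ∤ p`,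
`𝔓₀ = adicCompletionPrime K v`).  If the component group `Φ_v = X(K_v)/X₀(K_v)` of the minimal model
satisfies `Φ_v[p^k] ⊆ p Φ_v` (`hΦ`: every `φ` with `p^k • φ = 0` is `p • ψ`), then every `D_{𝔓₀}`-fixed
`p`-power torsion point `Q` with `p^k • Q` a core point (`I_{𝔓₀}`-fixed `p^j`-th roots for all `j`) is
`c + p • γ` with `c` a core point and `γ` `D_{𝔓₀}`-fixed.  PROOF: part IV's Galois descent
`δ : E[p^∞]^{D} → Φ_v` (route p2's construction `exists_point_map_eq_of_forall_map_eq`; additive; kernel =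
core by part III's `core = non-singular reduction`; image ⊇ `Φ_v[p^∞]` by
`exists_torsion_sub_mem_nonsingularReductionSubgroup`): `p^k • δ(Q) = δ(p^k • Q) = 0`, so `δ(Q) = p • ψ`,
`ψ ∈ Φ_v[p^∞] = δ(γ)`, and `Q − p • γ ∈ ker δ` is a core point.
[cite: GreenbergLNM1716, §3 Lemma 3.3 (p. 87) and §4 proof of Thm. 4.1 (p. 74)]
[cite: SilvermanAEC2009, §VII.6 (Ex. 7.6) and VIII.§1] -/
theorem exists_core_add_smul_of_componentQuotient (hpv : (p : 𝓞 K) ∉ v.asIdeal) (k : ℕ)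
    (hΦ : ∀ φ : ((W.localMinimalIntegralModel v).baseChange (v.adicCompletion K)).toAffine.Point ⧸
        (W.localMinimalIntegralModel v).nonsingularReductionSubgroup
          (integers_valuationRing_valuation (v.adicCompletionIntegers K) (v.adicCompletion K)),
      p ^ k • φ = 0 → ∃ ψ : ((W.localMinimalIntegralModel v).baseChange (v.adicCompletion K)).toAffine.Point ⧸
        (W.localMinimalIntegralModel v).nonsingularReductionSubgroup
          (integers_valuationRing_valuation (v.adicCompletionIntegers K) (v.adicCompletion K)),
        p • ψ = φ)
    (Q : W.geomPrimaryTorsion p)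
    (hQD : ∀ d ∈ (adicCompletionPrime K v).decompositionSubgroup (absoluteGaloisGroup K), d • Q = Q)
    (hQk : ∀ j : ℕ, ∃ y : W.geomPrimaryTorsion p,
      (∀ i ∈ (adicCompletionPrime K v).inertia (absoluteGaloisGroup K), i • y = y) ∧ p ^ j • y = p ^ k • Q) :
    ∃ c γ : W.geomPrimaryTorsion p,
      (∀ j : ℕ, ∃ y : W.geomPrimaryTorsion p,
        (∀ i ∈ (adicCompletionPrime K v).inertia (absoluteGaloisGroup K), i • y = y) ∧ p ^ j • y = c) ∧
      (∀ d ∈ (adicCompletionPrime K v).decompositionSubgroup (absoluteGaloisGroup K), d • γ = γ) ∧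
      Q = c + p • γ := by
  have hpp : (p : ℕ).Prime := hp.out
  -- (adapted from part IV `natCard_decompositionFixed_nsmul_core_eq`: the descent `δ`)
  obtain ⟨w, hw⟩ := v.exists_spectralValuation
  obtain ⟨𝔐, h𝔐⟩ := v.localPrimesAbove_nonempty
  have hint := WeierstrassCurve.isIntegral_spectralValuation_baseChange hw
    (W.localMinimalIntegralModel v)
  obtain ⟨W₀, hW₀⟩ := hint.integral
  obtain ⟨C, hC⟩ := W.exists_variableChange_eq_localMinimalIntegralModel v
  obtain ⟨Φ, hΦ'⟩ := W.exists_addEquiv_localPoints_of_smul_eq v hC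
  let X := (W.localMinimalIntegralModel v).map (algebraMap (v.adicCompletionIntegers K)
    (v.adicCompletion K))
  haveI : X.IsElliptic := W.isElliptic_map_localMinimalIntegralModel (v := v)
  set I : Subgroup (absoluteGaloisGroup K) := (adicCompletionPrime K v).inertia (absoluteGaloisGroup K)
    with hIdef
  set Dv : Subgroup (absoluteGaloisGroup K) :=
    (adicCompletionPrime K v).decompositionSubgroup (absoluteGaloisGroup K) with hDvdef
  have hIle : I ≤ Dv := Ideal.inertia_le_decompositionSubgroup _ _
  let Tor := W.geomPrimaryTorsion p
  let P : Tor → Prop := fun x => ∀ k : ℕ, ∃ y : Tor, (∀ i ∈ I, i • y = y) ∧ p ^ k • y = x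
  let D : AddSubgroup Tor :=
    { carrier := {t | ∀ d ∈ Dv, d • t = t}
      add_mem' := fun {a b} ha hb d hd ↦ by rw [smul_add, ha d hd, hb d hd]
      zero_mem' := fun d _ ↦ smul_zero d
      neg_mem' := fun {a} ha d hd ↦ by rw [smul_neg, ha d hd] }
  have hDmem : ∀ t : Tor, t ∈ D ↔ ∀ d ∈ Dv, d • t = t := fun _ ↦ Iff.rfl
  let E₀K := (W.localMinimalIntegralModel v).nonsingularReductionSubgroup
    (integers_valuationRing_valuation (v.adicCompletionIntegers K) (v.adicCompletion K))
  let ι := closureEmb (K := K) (v.adicCompletion K)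
  have hXid : X.baseChange (v.adicCompletion K) = X := by
    change X.map (algebraMap (v.adicCompletion K) (v.adicCompletion K)) = X
    rw [Algebra.algebraMap_self, WeierstrassCurve.map_id]
  -- the `I`-fixed point underlying `t ∈ D`
  have hDI : ∀ t : D, ∀ i ∈ I, i • ((t : Tor) : W.geomPoints) = ((t : Tor) : W.geomPoints) :=
    fun t i hi ↦ by rw [← primaryComponent.coe_smul, t.2 i (hIle hi)]
  -- the descended points are `Γ_{K_v}`-fixed
  have hfixD : ∀ (t : D) (σ : absoluteGaloisGroup (v.adicCompletion K)),
      Affine.Point.map ((absoluteGaloisGroup.toAlgEquiv _ σ :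
          AlgebraicClosure (v.adicCompletion K) ≃ₐ[v.adicCompletion K]
            AlgebraicClosure (v.adicCompletion K)) :
          AlgebraicClosure (v.adicCompletion K) →ₐ[v.adicCompletion K]
            AlgebraicClosure (v.adicCompletion K))
        (Φ (pointsMapOfEmb W ι ((t : Tor) : W.geomPoints))) =
        Φ (pointsMapOfEmb W ι ((t : Tor) : W.geomPoints)) := by
    intro t σ
    rw [← transport_pointsMapOfEmb_smul hΦ']
    congr 2
    have hmem : resGalOfEmb ι σ ∈ Dv := by
      rw [hDvdef, ← decomp_eq_decompositionSubgroup_adicCompletionPrime v]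
      exact resGalOfEmb_closureEmb_mem_decomp v σ
    rw [← primaryComponent.coe_smul, t.2 _ hmem]
  -- Galois descent `d₀ : D → X(K_v)`
  have hdesc : ∀ t : D, ∃ R : (X.baseChange (v.adicCompletion K)).toAffine.Point,
      Affine.Point.map (W' := X)
        (Algebra.ofId (v.adicCompletion K) (AlgebraicClosure (v.adicCompletion K))) R =
        Φ (pointsMapOfEmb W ι ((t : Tor) : W.geomPoints)) :=
    fun t ↦ exists_point_map_eq_of_forall_map_eq X (hfixD t)
  choose d₀ hd₀ using hdesc
  have hinj := Affine.Point.map_injective (W' := X)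
    (Algebra.ofId (v.adicCompletion K) (AlgebraicClosure (v.adicCompletion K)))
  have hd₀_zero : d₀ 0 = 0 := hinj (by
    rw [hd₀, map_zero]
    change Φ (pointsMapOfEmb W ι (((0 : D) : Tor) : W.geomPoints)) = 0
    rw [ZeroMemClass.coe_zero, ZeroMemClass.coe_zero, map_zero, map_zero])
  have hd₀_add : ∀ P Q : D, d₀ (P + Q) = d₀ P + d₀ Q := fun P Q ↦ hinj (by
    rw [map_add, hd₀, hd₀, hd₀]
    change Φ (pointsMapOfEmb W ι ((((P : D) + (Q : D) : D) : Tor) : W.geomPoints)) = _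
    rw [AddSubgroup.coe_add, AddSubgroup.coe_add, map_add, map_add])
  let d : D →+ ((W.localMinimalIntegralModel v).baseChange (v.adicCompletion K)).toAffine.Point :=
    { toFun := fun P ↦ Affine.Point.congrEquiv hXid (d₀ P)
      map_zero' := by
        change Affine.Point.congrEquiv hXid (d₀ 0) = 0
        rw [hd₀_zero, map_zero]
      map_add' := fun P Q ↦ by
        change Affine.Point.congrEquiv hXid (d₀ (P + Q)) =
          Affine.Point.congrEquiv hXid (d₀ P) + Affine.Point.congrEquiv hXid (d₀ Q)
        rw [hd₀_add, map_add] }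
  have hd : ∀ P : D, d P = Affine.Point.congrEquiv hXid (d₀ P) := fun _ ↦ rfl
  -- `d t ∈ X₀(K_v) ↔ t ∈ core`
  have hbridge₀ : ∀ t : D, d t ∈ E₀K ↔
      (⟨((t : Tor) : W.geomPoints), fun i ↦ hDI t i i.2⟩ :
        FixedPoints.addSubgroup ↥((adicCompletionPrime K v).inertia (absoluteGaloisGroup K))
          W.geomPoints) ∈ nonsingularPart W hW₀ Φ := by
    intro t
    rw [mem_nonsingularReductionSubgroup_iff, mem_nonsingularPart_iff, hd, ← hd₀ t]
    obtain hR0 | ⟨x₀, y₀, hxy, hR⟩ : d₀ t = 0 ∨ ∃ x₀ y₀ h, d₀ t = .some x₀ y₀ h := by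
      rcases d₀ t with _ | ⟨x, y, h⟩
      exacts [Or.inl rfl, Or.inr ⟨x, y, h, rfl⟩]
    · rw [hR0, map_zero, map_zero, map_zero]
      exact iff_of_true WeierstrassCurve.hasNonsingularReduction_zero
        WeierstrassCurve.hasNonsingularReduction_zero
    · rw [hR, Affine.Point.congrEquiv_some, Affine.Point.map_some, Affine.Point.congrEquiv_some]
      exact (hasNonsingularReduction_algebraMap_iff hw (W.localMinimalIntegralModel v) h𝔐 hW₀
        _ _).symm
  have hbridge : ∀ t : D, d t ∈ E₀K ↔ P (t : Tor) := by
    intro t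
    rw [hbridge₀ t]
    exact ⟨fun h ↦ core_of_mem_nonsingularPart W p hw hW₀ hΦ' hpv h𝔐 (t : Tor) _ rfl h,
      fun h ↦ mem_nonsingularPart_of_core W p hw hW₀ hΦ' (t : Tor) h _ rfl⟩
  -- `δ : D → Φ_v`, kernel = core
  let δ : D →+ _ ⧸ E₀K := (QuotientAddGroup.mk' E₀K).comp d
  have hδ : ∀ t : D, δ t = QuotientAddGroup.mk (d t) := fun _ ↦ rfl
  have hker : ∀ t : D, δ t = 0 ↔ P (t : Tor) := by
    intro t
    rw [hδ, QuotientAddGroup.eq_zero_iff, hbridge]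
  -- finiteness of `Φ_v`
  have hcv0 : (W.baseChange (v.adicCompletion K)).localTamagawaNumber (v.adicCompletionIntegers K) ≠ 0 :=
    W.localTamagawaNumber_baseChange_ne_zero v
  haveI hE₀fi : E₀K.FiniteIndex :=
    ⟨by rw [← localTamagawaNumber_eq_index_nonsingularReductionSubgroup]; exact hcv0⟩
  haveI : Finite (((W.localMinimalIntegralModel v).baseChange (v.adicCompletion K)).toAffine.Point ⧸ E₀K) :=
    AddSubgroup.finite_quotient_of_finiteIndex
  -- the image of `δ` contains the `p`-primary component of `Φ_v`
  have hrange : ∀ y : ((W.localMinimalIntegralModel v).baseChange (v.adicCompletion K)).toAffine.Point ⧸ E₀K,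
      y ∈ AddCommGroup.primaryComponent _ p → ∃ t : D, δ t = y := by
    intro y hy
    obtain ⟨k, hk⟩ := (AddCommGroup.mem_primaryComponent).mp hy
    obtain ⟨x, rfl⟩ := QuotientAddGroup.mk_surjective y
    have hkx : p ^ k • x ∈ E₀K := by
      rw [← QuotientAddGroup.eq_zero_iff, QuotientAddGroup.mk_nsmul]; exact hk
    -- a rational `p`-power torsion point `t ≡ x`
    obtain ⟨t, ⟨s, hts⟩, htx⟩ :=
      exists_torsion_sub_mem_nonsingularReductionSubgroup W hpv x ⟨k, hkx⟩
    -- `t` comes from a `D_v`-fixed `p`-power torsion point `Pt ∈ E(K̄)`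
    set t₁ := (Affine.Point.congrEquiv hXid).symm t with ht₁
    set Q' := Affine.Point.map (W' := X)
      (Algebra.ofId (v.adicCompletion K) (AlgebraicClosure (v.adicCompletion K))) t₁ with hQ'
    have ht₁s : p ^ s • t₁ = 0 := by
      rw [ht₁, ← map_nsmul]
      exact (congrArg _ hts).trans (map_zero _)
    have hQs : p ^ s • Q' = 0 := by rw [hQ', ← map_nsmul, ht₁s, map_zero]
    obtain ⟨Pt, hPts, hPt⟩ := exists_pointsMapOfEmb_eq_of_nsmul_eq_zero W ι
      (pow_ne_zero s hpp.ne_zero) (Q := Φ.symm Q') (by rw [← map_nsmul, hQs, map_zero])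
    have hΦPt : Φ (pointsMapOfEmb W ι Pt) = Q' := by rw [hPt, AddEquiv.apply_symm_apply]
    have hPtfix : ∀ g ∈ Dv, g • Pt = Pt := by
      intro g hg
      rw [hDvdef, ← decomp_eq_decompositionSubgroup_adicCompletionPrime v] at hg
      obtain ⟨σ, rfl⟩ := exists_eq_resGalOfEmb_of_mem_decomp v hg
      apply pointsMapOfEmb_injective W ι
      apply Φ.injective
      rw [transport_pointsMapOfEmb_smul hΦ', hΦPt, hQ']
      exact map_toAlgEquiv_map_ofId X t₁ σ
    have hPtprim : Pt ∈ W.geomPrimaryTorsion p :=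
      (AddCommGroup.mem_primaryComponent).mpr ⟨s, hPts⟩
    let bP : D := ⟨⟨Pt, hPtprim⟩, fun g hg ↦ Subtype.ext (by
      rw [primaryComponent.coe_smul]; exact hPtfix g hg)⟩
    refine ⟨bP, ?_⟩
    have hdt : d bP = t := by
      rw [hd]
      have : d₀ bP = t₁ := hinj (by
        rw [hd₀]
        change Φ (pointsMapOfEmb W ι Pt) = _
        rw [hΦPt, hQ'])
      rw [this, ht₁, AddEquiv.apply_symm_apply]
    rw [hδ, hdt, QuotientAddGroup.eq_iff_sub_mem]
    exact htx
  -- (new) the decomposition `Q = c + p • γ`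
  let bQ : D := ⟨Q, hQD⟩
  have h1 : p ^ k • δ bQ = 0 := by
    rw [← map_nsmul]
    exact (hker (p ^ k • bQ)).mpr hQk
  obtain ⟨ψ, hψ⟩ := hΦ (δ bQ) h1
  -- `ψ` is `p`-primary: `Q` is
  obtain ⟨m, hm⟩ := (AddCommGroup.mem_primaryComponent).mp Q.2
  have hQm : p ^ m • bQ = 0 := Subtype.ext (Subtype.ext (by
    rw [AddSubgroup.coe_nsmul, AddSubmonoidClass.coe_nsmul, AddSubgroup.coe_zero, ZeroMemClass.coe_zero]
    exact hm))
  have hψprim : ψ ∈ AddCommGroup.primaryComponent _ p := by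
    refine (AddCommGroup.mem_primaryComponent).mpr ⟨m + 1, ?_⟩
    rw [pow_succ, mul_smul, hψ, ← map_nsmul, hQm, map_zero]
  obtain ⟨γ', hγ'⟩ := hrange ψ hψprim
  refine ⟨Q - p • (γ' : Tor), (γ' : Tor), ?_, γ'.2, by abel⟩
  have e : Q - p • (γ' : Tor) = ((bQ - p • γ' : D) : Tor) := by
    rw [AddSubgroup.coe_sub, AddSubgroup.coe_nsmul]
  rw [e]
  refine (hker _).mp ?_
  rw [map_sub, map_nsmul, hγ', hψ, sub_self]

end Descent

/-! ### §2 Dischargers of `Φ_w[p^k] ⊆ p Φ_w` over `ℚ` -/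

section Dischargers

variable (W : WeierstrassCurve ℚ) [W.IsElliptic] (p : ℕ) [hp : Fact p.Prime] (k : ℕ)
  (w : HeightOneSpectrum (𝓞 ℚ))

omit [W.IsElliptic] in
/-- **`p ∤ c_w` ⇒ the hypothesis `Φ_w[p^k] ⊆ p Φ_w` holds for every `k`** (`Φ_w` has order `c_w` prime to `p`,
so `p^k • φ = 0` forces `φ = 0`): at a Tamagawa-free place `𝓕_u` is cartesian at every level (there
`𝓕_u(w) = 𝓕_can(w)`, part VI / seat gen 3). [cite: Buyukboduk2009TamagawaDefect, Lemma 2.6 (§2.4)] -/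
theorem componentQuotient_torsionBy_le_smul_of_not_dvd
    (hc : ¬ p ∣ (W.baseChange (w.adicCompletion ℚ)).localTamagawaNumber (w.adicCompletionIntegers ℚ))
    (φ : ((W.localMinimalIntegralModel w).baseChange (w.adicCompletion ℚ)).toAffine.Point ⧸
        (W.localMinimalIntegralModel w).nonsingularReductionSubgroup
          (integers_valuationRing_valuation (w.adicCompletionIntegers ℚ) (w.adicCompletion ℚ)))
    (hφ : p ^ k • φ = 0) :
    ∃ ψ : ((W.localMinimalIntegralModel w).baseChange (w.adicCompletion ℚ)).toAffine.Point ⧸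
        (W.localMinimalIntegralModel w).nonsingularReductionSubgroup
          (integers_valuationRing_valuation (w.adicCompletionIntegers ℚ) (w.adicCompletion ℚ)),
      p • ψ = φ := by
  refine ⟨0, ?_⟩
  rw [smul_zero]
  -- the order of `φ` divides `p^k` and `#Φ_w = c_w`, coprime to `p`
  have h1 : addOrderOf φ ∣ p ^ k := addOrderOf_dvd_iff_nsmul_eq_zero.mpr hφ
  have h2 : addOrderOf φ ∣ (W.baseChange (w.adicCompletion ℚ)).localTamagawaNumber (w.adicCompletionIntegers ℚ) := by
    rw [← natCard_componentQuotient_eq_localTamagawaNumber]; exact addOrderOf_dvd_natCard φ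
  have hcop : Nat.Coprime (p ^ k) ((W.baseChange (w.adicCompletion ℚ)).localTamagawaNumber
      (w.adicCompletionIntegers ℚ)) :=
    (Nat.Coprime.pow_left k ((Nat.Prime.coprime_iff_not_dvd hp.out).mpr hc))
  have h3 : addOrderOf φ ∣ 1 := by
    rw [← hcop.gcd_eq_one]; exact Nat.dvd_gcd h1 h2
  exact (AddMonoid.addOrderOf_eq_one_iff.mp (Nat.dvd_one.mp h3)).symm

/-- **The cyclic case**: if the `p`-primary part of `Φ_w` is generated by one element and `p^{k+1}` divides
`c_w = #Φ_w`, then `Φ_w[p^k] ⊆ p Φ_w` (a cyclic group of order `p^v`, `v = v_p(c_w) ≥ k + 1`, has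
`p^k`-torsion `p^{v−k}ℤ/p^v ⊆ pℤ/p^v`).  By Kodaira–Néron `Φ_w[p^∞]` is cyclic for every odd `p` (split
`I_n`: `Φ_w ≅ ℤ/n`; otherwise `c_w ≤ 4`), so for `p = 3` this is the condition «`3 ∤ c_w` or `3^{k+1} ∣ c_w`».
[cite: Buyukboduk2009TamagawaDefect, Thm. 3.1 and Cor. 3.3 (§3)] [cite: SilvermanAEC2009, Thm. VII.6.1 and Cor. C.15.2.1] -/
theorem componentQuotient_torsionBy_le_smul_of_generator
    {g : ((W.localMinimalIntegralModel w).baseChange (w.adicCompletion ℚ)).toAffine.Point ⧸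
        (W.localMinimalIntegralModel w).nonsingularReductionSubgroup
          (integers_valuationRing_valuation (w.adicCompletionIntegers ℚ) (w.adicCompletion ℚ))}
    (hg : ∀ φ : ((W.localMinimalIntegralModel w).baseChange (w.adicCompletion ℚ)).toAffine.Point ⧸
        (W.localMinimalIntegralModel w).nonsingularReductionSubgroup
          (integers_valuationRing_valuation (w.adicCompletionIntegers ℚ) (w.adicCompletion ℚ)),
      (∃ m : ℕ, p ^ m • φ = 0) → ∃ a : ℕ, a • g = φ)
    (hgp : ∃ m : ℕ, p ^ m • g = 0)
    (hk : p ^ (k + 1) ∣ (W.baseChange (w.adicCompletion ℚ)).localTamagawaNumber (w.adicCompletionIntegers ℚ))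
    (φ : ((W.localMinimalIntegralModel w).baseChange (w.adicCompletion ℚ)).toAffine.Point ⧸
        (W.localMinimalIntegralModel w).nonsingularReductionSubgroup
          (integers_valuationRing_valuation (w.adicCompletionIntegers ℚ) (w.adicCompletion ℚ)))
    (hφ : p ^ k • φ = 0) :
    ∃ ψ : ((W.localMinimalIntegralModel w).baseChange (w.adicCompletion ℚ)).toAffine.Point ⧸
        (W.localMinimalIntegralModel w).nonsingularReductionSubgroup
          (integers_valuationRing_valuation (w.adicCompletionIntegers ℚ) (w.adicCompletion ℚ)),
      p • ψ = φ := by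
  have hpp : p.Prime := hp.out
  haveI := finite_componentQuotient W w
  -- the `p`-primary part is `⟨g⟩`, of order `p^{v_p(c_w)}`; so `addOrderOf g = p^{v_p(c_w)} =: p^v`
  have hprim : Nat.card (AddCommGroup.primaryComponent
      (((W.localMinimalIntegralModel w).baseChange (w.adicCompletion ℚ)).toAffine.Point ⧸
        (W.localMinimalIntegralModel w).nonsingularReductionSubgroup
          (integers_valuationRing_valuation (w.adicCompletionIntegers ℚ) (w.adicCompletion ℚ))) p) =
      p ^ padicValNat p ((W.baseChange (w.adicCompletion ℚ)).localTamagawaNumber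
        (w.adicCompletionIntegers ℚ)) := by
    rw [Literature.NumberTheory.EllipticCurves.natCard_primaryComponent_eq_pow_padicValNat p,
      natCard_componentQuotient_eq_localTamagawaNumber]
  have hgmem : g ∈ AddCommGroup.primaryComponent
      (((W.localMinimalIntegralModel w).baseChange (w.adicCompletion ℚ)).toAffine.Point ⧸
        (W.localMinimalIntegralModel w).nonsingularReductionSubgroup
          (integers_valuationRing_valuation (w.adicCompletionIntegers ℚ) (w.adicCompletion ℚ))) p :=
    (AddCommGroup.mem_primaryComponent).mpr hgp
  have hzm : AddSubgroup.zmultiples g = AddCommGroup.primaryComponent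
      (((W.localMinimalIntegralModel w).baseChange (w.adicCompletion ℚ)).toAffine.Point ⧸
        (W.localMinimalIntegralModel w).nonsingularReductionSubgroup
          (integers_valuationRing_valuation (w.adicCompletionIntegers ℚ) (w.adicCompletion ℚ))) p := by
    apply le_antisymm
    · rw [AddSubgroup.zmultiples_le]; exact hgmem
    · intro φ' hφ'
      obtain ⟨a, ha⟩ := hg φ' ((AddCommGroup.mem_primaryComponent).mp hφ')
      exact ha ▸ AddSubgroup.nsmul_mem _ (AddSubgroup.mem_zmultiples g) a
  have hord : addOrderOf g = p ^ padicValNat p ((W.baseChange (w.adicCompletion ℚ)).localTamagawaNumber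
      (w.adicCompletionIntegers ℚ)) := by
    rw [← Nat.card_zmultiples g, hzm, ← hprim]
  have hkv : k + 1 ≤ padicValNat p ((W.baseChange (w.adicCompletion ℚ)).localTamagawaNumber
      (w.adicCompletionIntegers ℚ)) := by
    have hc0 : (W.baseChange (w.adicCompletion ℚ)).localTamagawaNumber (w.adicCompletionIntegers ℚ) ≠ 0 :=
      W.localTamagawaNumber_baseChange_ne_zero w
    exact (padicValNat_dvd_iff_le hc0).mp hk
  -- `φ = a • g` with `p^v ∣ p^k a`, so `p ∣ a`
  obtain ⟨a, rfl⟩ := hg φ ⟨k, hφ⟩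
  have hdvd : p ^ padicValNat p ((W.baseChange (w.adicCompletion ℚ)).localTamagawaNumber
      (w.adicCompletionIntegers ℚ)) ∣ p ^ k * a := by
    rw [← hord]; apply addOrderOf_dvd_iff_nsmul_eq_zero.mpr; rw [mul_smul]; exact hφ
  have hpa : p ∣ a := by
    have h : p ^ (k + 1) ∣ p ^ k * a := (pow_dvd_pow p hkv).trans hdvd
    rw [pow_succ] at h
    exact Nat.dvd_of_mul_dvd_mul_left (pow_pos hpp.pos k) h
  obtain ⟨b, rfl⟩ := hpa
  exact ⟨b • g, by rw [smul_smul]⟩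

end Dischargers

end Summit.BirchSwinnertonDyer.BirchSwinnertonDyer.Theorems.KimAtThreeD7uTamagawaCartesian

end
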